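import Mathlib
import HarnessLib
import Summits.HodgeConjecture.FermatCycles.ConeVertexTangent

/-!
# Fermat cycles — `(10, 69)`: kernel record of the SECOND-ORDER vertex identity (ENGINE v12.5, CSCROLL v3)

HONEST FRAMING: explicit algebraic cycles for specific Hodge classes on Fermat/Delsarte varieties;
residual open instances listed; no claim on general Hodge.

Cell `pub-hfermat`, track FIND-THE-CLASS, seat ftc-engine gen-15; companion of `ftc/certs/W69/CSCROLL.md` §8 (v3) and of
`ConeVertexTangent.lean` (gen-14, first order).  For a polynomial `F` over a commutative ring and the parametrised line
`t ↦ p + t • w` this file records, as identities of polynomials: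
* the CHAIN RULE along the line, `d/dt F(p + t w) = ∑ i, w i · (∂F/∂yᵢ)(p + t w)` (as polynomials in `t`, not only at `t = 0`);
* the second derivative at `t = 0` is the HESSIAN quadratic form `∑ i j, w i * w j * (∂²F/∂yⱼ∂yᵢ)(p)`;
* hence, if the whole line lies in `{F = 0}`, that form vanishes at `w` (together with the first-order identity of
  `ConeVertexTangent`: the directions of the lines of a cone through its vertex `p` lie on the quadric `{Q_p = 0}` of the
  Hessian at `p`).
This is the part of the 'Hessian lemma' of CSCROLL that is TRUE and used in words; the rank DEVICE that ENGINE v12.2 built on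
it was found defective and is withdrawn in v12.5 (CSCROLL.md §8 (c2)) — nothing in this file depends on or supports that
device.  Nothing here is a cycle, a class or a Hodge-theoretic statement: `(10,69)` is OPEN.
-/

namespace Summit.HodgeConjecture.FermatCycles.ConeVertexHessian

open MvPolynomial Summit.HodgeConjecture.FermatCycles.ConeVertexTangent

variable {σ : Type*} {R : Type*} [CommRing R]

/-- Restriction to the line is multiplicative. -/
@[simp] theorem lineRestrict_mul (F G : MvPolynomial σ R) (p w : σ → R) :
    lineRestrict (F * G) p w = lineRestrict F p w * lineRestrict G p w := by
  simp [lineRestrict]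

/-- Restriction of a coordinate function: `yᵢ(p + t w) = pᵢ + wᵢ t`. -/
@[simp] theorem lineRestrict_X (i : σ) (p w : σ → R) :
    lineRestrict (X i : MvPolynomial σ R) p w = Polynomial.C (p i) + Polynomial.C (w i) * Polynomial.X := by
  simp [lineRestrict]

/-- Restriction of zero. -/
@[simp] theorem lineRestrict_zero (p w : σ → R) : lineRestrict (0 : MvPolynomial σ R) p w = 0 := by
  simp [lineRestrict]

/-- CHAIN RULE along the line, as an identity of polynomials in `t`:
`d/dt F(p + t w) = ∑ i, w i · (∂F/∂yᵢ)(p + t w)`. -/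
theorem derivative_lineRestrict [Fintype σ] [DecidableEq σ] (F : MvPolynomial σ R) (p w : σ → R) :
    Polynomial.derivative (lineRestrict F p w) = ∑ i, Polynomial.C (w i) * lineRestrict (pderiv i F) p w := by
  induction F using MvPolynomial.induction_on with
  | C a => simp
  | add F G hF hG =>
      simp only [lineRestrict_add, hF, hG, map_add, mul_add, Finset.sum_add_distrib]
  | mul_X F i hF =>
      have hd : Polynomial.derivative (Polynomial.C (p i) + Polynomial.C (w i) * Polynomial.X) = Polynomial.C (w i) := by
        simp
      have hr : ∀ j, lineRestrict (pderiv j (F * X i)) p w =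
          lineRestrict (pderiv j F) p w * (Polynomial.C (p i) + Polynomial.C (w i) * Polynomial.X)
            + (if i = j then lineRestrict F p w else 0) := by
        intro j
        rw [(pderiv j).leibniz F (X i), pderiv_X]
        simp only [Pi.single_apply, smul_eq_mul]
        split_ifs with h
        · simp only [mul_one, lineRestrict_add, lineRestrict_mul, lineRestrict_X]
          ring
        · simp only [mul_zero, zero_add, lineRestrict_mul, lineRestrict_X, add_zero]
          ring
      have hs : lineRestrict F p w * Polynomial.C (w i) =
          ∑ j, (if i = j then Polynomial.C (w j) * lineRestrict F p w else 0) := by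
        rw [Finset.sum_ite_eq, if_pos (Finset.mem_univ _)]
        ring
      rw [lineRestrict_mul_X, Polynomial.derivative_mul, hF, hd, hs, Finset.sum_mul, ← Finset.sum_add_distrib]
      refine Finset.sum_congr rfl fun j _ => ?_
      rw [hr j]
      split_ifs <;> ring

/-- The SECOND derivative of `t ↦ F (p + t • w)` at `t = 0` is the Hessian quadratic form of `F` at `p` evaluated at `w`:
`∑ i j, w i * w j * (∂²F/∂yⱼ∂yᵢ)(p)`. -/
theorem derivative_two_lineRestrict_eval_zero [Fintype σ] [DecidableEq σ] (F : MvPolynomial σ R) (p w : σ → R) :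
    (Polynomial.derivative (Polynomial.derivative (lineRestrict F p w))).eval 0 =
      ∑ i, ∑ j, w i * w j * MvPolynomial.eval p (pderiv j (pderiv i F)) := by
  rw [derivative_lineRestrict, Polynomial.derivative_sum, Polynomial.eval_finsetSum]
  refine Finset.sum_congr rfl fun i _ => ?_
  rw [Polynomial.derivative_mul, Polynomial.derivative_C, zero_mul, zero_add, Polynomial.eval_mul, Polynomial.eval_C,
    derivative_lineRestrict_eval_zero, Finset.mul_sum]
  exact Finset.sum_congr rfl fun j _ => by ring

/-- SECOND-ORDER VERTEX IDENTITY: if the whole line `t ↦ p + t • w` lies in the hypersurface `{F = 0}`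
(`F (p + t • w) ≡ 0` as a polynomial in `t`), then the Hessian quadratic form of `F` at `p` vanishes at the direction `w`. -/
theorem hessian_form_of_line_subset [Fintype σ] [DecidableEq σ] {F : MvPolynomial σ R} {p w : σ → R}
    (h : lineRestrict F p w = 0) :
    ∑ i, ∑ j, w i * w j * MvPolynomial.eval p (pderiv j (pderiv i F)) = 0 := by
  rw [← derivative_two_lineRestrict_eval_zero, h, Polynomial.derivative_zero, Polynomial.derivative_zero,
    Polynomial.eval_zero]

/-- Both orders together: a direction `w` of a line of `{F = 0}` through `p` is annihilated by the gradient of `F` at `p`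
AND lies on the quadric of the Hessian of `F` at `p` (at a singular point `p` the first condition is void and the second says:
the lines of `{F = 0}` through `p` have their directions on the quadric cone `{Q_p = 0}`). -/
theorem gradient_and_hessian_of_line_subset [Fintype σ] [DecidableEq σ] {F : MvPolynomial σ R} {p w : σ → R}
    (h : lineRestrict F p w = 0) :
    (∑ i, w i * MvPolynomial.eval p (pderiv i F) = 0) ∧
      (∑ i, ∑ j, w i * w j * MvPolynomial.eval p (pderiv j (pderiv i F)) = 0) :=
  ⟨tangent_of_line_subset h, hessian_form_of_line_subset h⟩

end Summit.HodgeConjecture.FermatCycles.ConeVertexHessian
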